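import Summits.BirchSwinnertonDyer.Rank1Residual.GaloisImage.StarkVolumeForms
import HarnessLib

/-!
# Contraction of volume forms along global functionals (pure linear algebra over a field; cell
# `b2b-bsdres`, team n1011, ROUTE-1 item R1-56 "S24(1) @ m = 1 in the kernel", row T-R1-56-S,
# FILE C = K4a, part 2 of 3)

HONEST FRAMING (cell `b2b-bsdres`, verbatim): research route; prove what is provable now; no claim
beyond stated classes; nothing booked; no mark / label moved.  PURE LINEAR ALGEBRA over a field `k`
— no Galois cohomology, no arithmetic.  Theorems only: no definition, no named fact.

## What

For volume forms on a subspace `W′ ≤ V` (`VolumeForm.volOn σ W′`, part 1 `StarkVolumeForms.lean`)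
and the slot restriction `restrictSlots ω e t` along an injection `e : ι ↪ σ` freezing the other
slots at global functionals `t_s`: (1) the restriction is a volume form on the subspace
`W = {v ∈ W′ : t_s v = 0 for all frozen s}` (`restrictSlots_mem_volOn` — Mazur–Rubin JTNB 28
(2016) Prop. A.1 (i) in the dual picture); (2) when `#σ = dim W′` and `#ι = dim W` the frozen
functionals are independent on `W′` (`linearIndependent_domRestrict_of_finrank`), the restriction
of a non-zero volume form is non-zero (`restrictSlots_ne_zero` — op. cit. Lemma 6.4 (iii)/(iv) at
rank one over a field), restriction is injective on volume forms (`restrictSlots_injOn`) and onto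
the volume forms of `W` (`exists_restrictSlots_eq`): the two LINES of volume forms are identified.

References: B. Mazur, K. Rubin, *Controlling Selmer groups in the higher core rank case*, J. Théor.
Nombres Bordeaux 28 (2016) 145–183 (= arXiv:1312.4052), Def. 6.1, Lemma 6.4, Appendix A Prop. A.1
(read 2026-08-21, held).
-/

noncomputable section

open Function Module

namespace Summit.BirchSwinnertonDyer.Rank1Residual.GaloisImage.VolumeForm

/-! ## §4. Contraction along global functionals: `volOn σ W′ → volOn ι W`, `W = W′ ⊓ ⋂ ker t_s` -/

section Contract

variable {k : Type*} [Field k] {V : Type*} [AddCommGroup V] [Module k V] {ι σ : Type*}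

/-- **Restricting slots carries volume forms on `W′` to volume forms on `W`**, where `W ≤ W′` is cut
out of `W′` by the frozen functionals `t_s`, `s ∉ range e` (hypothesis: a vector of `W′` killed by
all frozen `t_s` lies in `W`).  Proof: an argument `x_i` annihilating `W` agrees on `W′` with a
combination `∑ c_s t_s` of the frozen functionals (finite intersection of kernels,
`mem_span_of_iInf_ker_le_ker`); expanding in slot `e i`, every term has either two equal slots or
a slot annihilating `W′`. (Mazur–Rubin JTNB 28 (2016) Prop. A.1 (i), dual picture.) [folklore] -/
theorem restrictSlots_mem_volOn [Finite σ] {W W' : Submodule k V}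
    {ω : (Module.Dual k V) [⋀^σ]→ₗ[k] k} (hω : ω ∈ volOn σ W') {e : ι → σ} (he : Injective e)
    (t : σ → Module.Dual k V)
    (hW : ∀ v ∈ W', (∀ s, s ∉ Set.range e → t s v = 0) → v ∈ W) :
    restrictSlots ω he t ∈ volOn ι W := by
  classical
  intro x i hxi
  rw [restrictSlots_apply]
  -- the frozen slots and their functionals restricted to `W'`
  let J := {s : σ // s ∉ Set.range e}
  haveI : Fintype J := Fintype.ofFinite J
  let L : J → (W' →ₗ[k] k) := fun s => (t s.1).domRestrict W'
  have hker : (⨅ s, LinearMap.ker (L s)) ≤ LinearMap.ker ((x i).domRestrict W') := by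
    intro v hv
    rw [LinearMap.mem_ker, LinearMap.domRestrict_apply]
    refine hxi v (hW v v.2 fun s hs => ?_)
    have := (Submodule.mem_iInf _).mp hv ⟨s, hs⟩
    rwa [LinearMap.mem_ker, LinearMap.domRestrict_apply] at this
  obtain ⟨c, hc⟩ :=
    (Submodule.mem_span_range_iff_exists_fun k).mp (mem_span_of_iInf_ker_le_ker hker)
  -- `x i = (∑ c_s t_s) + a` with `a` annihilating `W'`
  set a : Module.Dual k V := x i - ∑ s : J, c s • t s.1 with ha_def
  have ha : ∀ w ∈ W', a w = 0 := by
    intro w hw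
    have h := LinearMap.congr_fun hc ⟨w, hw⟩
    simp only [LinearMap.coe_sum, Finset.sum_apply, LinearMap.smul_apply,
      LinearMap.domRestrict_apply, L] at h
    simp only [ha_def, LinearMap.sub_apply, LinearMap.coe_sum, Finset.sum_apply,
      LinearMap.smul_apply, h, sub_self]
  -- expand in the slot `e i`
  set F := Function.extend e x t with hF_def
  have hFi : F (e i) = x i := by rw [hF_def, he.extend_apply]
  have hxi' : x i = (∑ s : J, c s • t s.1) + a := by rw [ha_def]; abel
  have hF : F = update F (e i) ((∑ s : J, c s • t s.1) + a) := by
    rw [← hxi', ← hFi, update_eq_self]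
  rw [hF, show ω (update F (e i) ((∑ s : J, c s • t s.1) + a)) =
      ω.toMultilinearMap.toLinearMap F (e i) ((∑ s : J, c s • t s.1) + a) from rfl,
    map_add, map_sum]
  have h1 : ∀ s : J, ω.toMultilinearMap.toLinearMap F (e i) (c s • t s.1) = 0 := by
    intro s
    rw [map_smul, MultilinearMap.toLinearMap_apply, smul_eq_zero]
    right
    have hs : s.1 ≠ e i := fun h => s.2 ⟨i, h.symm⟩
    refine ω.map_eq_zero_of_eq _ (i := e i) (j := s.1) ?_ hs.symm
    rw [update_self, update_of_ne hs, hF_def, extend_apply' _ _ _ s.2]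
  have h2 : ω.toMultilinearMap.toLinearMap F (e i) a = 0 := by
    rw [MultilinearMap.toLinearMap_apply]
    exact hω _ (e i) fun w hw => by rw [update_self]; exact ha w hw
  simp only [h1, Finset.sum_const_zero, h2, add_zero]

/-- **Functionals cutting out a subspace of the expected codimension are independent**: if the global
functionals `t_j` (`j : J`) kill `W`, cut `W` out of `W′ ≥ W`, and `dim W + #J = dim W′`, then the
restrictions `t_j|_{W′}` are linearly independent (rank–nullity through the dual coannihilator,
`Subspace.finrank_add_finrank_dualCoannihilator_eq`). [folklore] -/
theorem linearIndependent_domRestrict_of_finrank_add {J : Type*} [Fintype J]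
    {W W' : Submodule k V} [FiniteDimensional k W'] (t : J → Module.Dual k V) (hWW' : W ≤ W')
    (hWt : ∀ j, ∀ w ∈ W, t j w = 0) (hW : ∀ v ∈ W', (∀ j, t j v = 0) → v ∈ W)
    (hdim : Module.finrank k W + Fintype.card J = Module.finrank k W') :
    LinearIndependent k fun j => (t j).domRestrict W' := by
  classical
  let Φ : Submodule k (Module.Dual k W') := Submodule.span k (Set.range fun j => (t j).domRestrict W')
  -- the coannihilator of `Φ` is `W` seen inside `W'`
  have hU : Φ.dualCoannihilator.map W'.subtype = W := by
    apply le_antisymm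
    · rintro _ ⟨v, hv, rfl⟩
      refine hW v v.2 fun j => ?_
      have := (Submodule.mem_dualCoannihilator _).mp hv ((t j).domRestrict W')
        (Submodule.subset_span ⟨j, rfl⟩)
      rwa [LinearMap.domRestrict_apply] at this
    · intro v hv
      refine Submodule.mem_map.mpr ⟨⟨v, hWW' hv⟩, ?_, rfl⟩
      rw [Submodule.mem_dualCoannihilator]
      intro φ hφ
      refine Submodule.span_induction ?_ ?_ ?_ ?_ hφ
      · rintro _ ⟨j, rfl⟩
        rw [LinearMap.domRestrict_apply]
        exact hWt j v hv
      · rfl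
      · intro _ _ _ _ h1 h2; rw [LinearMap.add_apply, h1, h2, add_zero]
      · intro c _ _ h; rw [LinearMap.smul_apply, h, smul_zero]
  have hfinU : Module.finrank k Φ.dualCoannihilator = Module.finrank k W := by
    rw [← LinearEquiv.finrank_eq
      (Submodule.equivMapOfInjective W'.subtype W'.injective_subtype Φ.dualCoannihilator).symm, hU]
  have hdim' := Subspace.finrank_add_finrank_dualCoannihilator_eq Φ
  rw [hfinU, ← hdim] at hdim'
  apply linearIndependent_iff_card_eq_finrank_span.mpr
  change Fintype.card J = Module.finrank k Φ
  omega

/-- The frozen functionals, restricted to `W′`, are linearly independent as soon as the subspace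
`W ≤ W′` they cut out has the expected codimension `#σ − #ι`. [folklore] -/
theorem linearIndependent_domRestrict_of_finrank [Fintype σ] [Fintype ι]
    {W W' : Submodule k V} [FiniteDimensional k W'] {e : ι → σ} (he : Injective e)
    (t : σ → Module.Dual k V) (hWW' : W ≤ W')
    (hWt : ∀ s, s ∉ Set.range e → ∀ w ∈ W, t s w = 0)
    (hW : ∀ v ∈ W', (∀ s, s ∉ Set.range e → t s v = 0) → v ∈ W)
    (hσ : Fintype.card σ = Module.finrank k W') (hι : Fintype.card ι = Module.finrank k W) :
    LinearIndependent k fun s : {s : σ // s ∉ Set.range e} => (t s.1).domRestrict W' := by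
  classical
  have hJ : Fintype.card {s : σ // s ∉ Set.range e} = Fintype.card σ - Fintype.card ι := by
    rw [Fintype.card_subtype_compl, Set.card_range_of_injective he]
  have hle : Fintype.card ι ≤ Fintype.card σ := Fintype.card_le_of_injective e he
  refine linearIndependent_domRestrict_of_finrank_add (fun s : {s : σ // s ∉ Set.range e} => t s.1)
    hWW' (fun j => hWt j.1 j.2) (fun v hv h => hW v hv fun s hs => h ⟨s, hs⟩) ?_
  omega

/-- The relation form of `linearIndependent_domRestrict_of_finrank`: a vanishing combination over
ALL slots `s : σ` of the restricted frozen functionals `t_s|_{W′}`, whose coefficients vanish on the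
free slots `range e`, has all coefficients zero. [folklore] -/
theorem forall_eq_zero_of_sum_smul_domRestrict_eq_zero [Fintype σ] [Fintype ι]
    {W W' : Submodule k V} [FiniteDimensional k W'] {e : ι → σ} (he : Injective e)
    (t : σ → Module.Dual k V) (hWW' : W ≤ W')
    (hWt : ∀ s, s ∉ Set.range e → ∀ w ∈ W, t s w = 0)
    (hW : ∀ v ∈ W', (∀ s, s ∉ Set.range e → t s v = 0) → v ∈ W)
    (hσ : Fintype.card σ = Module.finrank k W') (hι : Fintype.card ι = Module.finrank k W)
    (g : σ → k) (hge : ∀ i, g (e i) = 0) (hrel : ∑ s, g s • (t s).domRestrict W' = 0) (s : σ) :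
    g s = 0 := by
  classical
  by_cases hs : s ∈ Set.range e
  · obtain ⟨i, rfl⟩ := hs; exact hge i
  have hind := Fintype.linearIndependent_iff.mp
    (linearIndependent_domRestrict_of_finrank he t hWW' hWt hW hσ hι) (fun j => g j.1)
  refine hind ?_ ⟨s, hs⟩
  -- the sum over the frozen slots is the full sum (the free slots contribute zero)
  have hsub : ∑ j : {s : σ // s ∉ Set.range e}, g j.1 • (t j.1).domRestrict W' =
      ∑ s ∈ Finset.univ.filter (fun s => s ∉ Set.range e), g s • (t s).domRestrict W' :=
    (Finset.sum_subtype _ (fun x => by simp) (fun s => g s • (t s).domRestrict W')).symm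
  rw [hsub, Finset.sum_filter_of_ne, hrel]
  intro x _ hx hxr
  obtain ⟨i, rfl⟩ := hxr
  exact hx (by rw [hge i, zero_smul])

/-- **Contraction is injective on volume forms when the dimensions match**: if `ω ≠ 0` is a volume
form on `W′` (`#σ = dim W′`) and `W ≤ W′` is cut out by the frozen functionals with `#ι = dim W`,
then `restrictSlots ω e t ≠ 0` — it does not vanish on lifts of a dual basis of `W`, because these
together with the frozen functionals restrict to a basis of `W′^*` (Mazur–Rubin JTNB 28 (2016)
Lemma 6.4 (iii)/(iv) at `r = 1` over a field). [folklore] -/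
theorem restrictSlots_ne_zero [Fintype σ] [Fintype ι] [DecidableEq σ] [DecidableEq ι]
    {W W' : Submodule k V} [FiniteDimensional k W'] [FiniteDimensional k W]
    {ω : (Module.Dual k V) [⋀^σ]→ₗ[k] k} (hω : ω ∈ volOn σ W') (hω0 : ω ≠ 0)
    {e : ι → σ} (he : Injective e) (t : σ → Module.Dual k V) (hWW' : W ≤ W')
    (hWt : ∀ s, s ∉ Set.range e → ∀ w ∈ W, t s w = 0)
    (hW : ∀ v ∈ W', (∀ s, s ∉ Set.range e → t s v = 0) → v ∈ W)
    (hσ : Fintype.card σ = Module.finrank k W') (hι : Fintype.card ι = Module.finrank k W) :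
    restrictSlots ω he t ≠ 0 := by
  classical
  -- a basis of `W` indexed by `ι`, and lifts of its dual basis
  let b : Basis ι k W :=
    (Module.finBasisOfFinrankEq k W hι.symm).reindex (Fintype.equivFinOfCardEq rfl).symm
  let x : ι → Module.Dual k V := fun i => Subspace.dualLift W (b.dualBasis i)
  suffices h : restrictSlots ω he t x ≠ 0 from fun h0 => h (by rw [h0, AlternatingMap.zero_apply])
  rw [restrictSlots_apply]
  refine apply_ne_zero_of_linearIndependent hσ hω hω0 ?_
  -- the family `extend e x t`, restricted to `W'`, is linearly independent
  set F := Function.extend e x t with hF_def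
  have hFe : ∀ i, F (e i) = x i := fun i => by rw [hF_def, he.extend_apply]
  have hFt : ∀ s, s ∉ Set.range e → F s = t s := fun s hs => by
    rw [hF_def, extend_apply' _ _ _ (by rintro ⟨i, rfl⟩; exact hs ⟨i, rfl⟩)]
  -- values on the basis vectors `b j ∈ W`
  have hFb : ∀ (s : σ) (j : ι), F s (b j : V) = if s = e j then 1 else 0 := by
    intro s j
    by_cases hs : s ∈ Set.range e
    · obtain ⟨i, rfl⟩ := hs
      rw [hFe, show (x i) (b j : V) = b.dualBasis i (b j) from Subspace.dualLift_of_subtype _,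
        b.dualBasis_apply_self]
      by_cases hji : j = i
      · subst hji; simp
      · rw [if_neg hji, if_neg (fun h => hji (he h).symm)]
    · rw [hFt s hs, hWt s hs _ (b j).2, if_neg]
      rintro rfl; exact hs ⟨j, rfl⟩
  rw [Fintype.linearIndependent_iff]
  intro g hg s₀
  -- evaluate the relation at `b j`: the coefficients on `range e` vanish
  have hge : ∀ j, g (e j) = 0 := by
    intro j
    have h := LinearMap.congr_fun hg ⟨(b j : V), hWW' (b j).2⟩
    simp only [LinearMap.coe_sum, Finset.sum_apply, LinearMap.smul_apply,
      Submodule.dualRestrict_apply, LinearMap.zero_apply, hFb, smul_eq_mul, mul_ite, mul_one,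
      mul_zero, Finset.sum_ite_eq', Finset.mem_univ, if_true] at h
    exact h
  -- the remaining relation is among the frozen functionals only
  refine forall_eq_zero_of_sum_smul_domRestrict_eq_zero he t hWW' hWt hW hσ hι g hge ?_ s₀
  rw [← hg]
  refine Finset.sum_congr rfl fun s _ => ?_
  by_cases hs : s ∈ Set.range e
  · obtain ⟨i, rfl⟩ := hs
    rw [hge i, zero_smul, zero_smul]
  · rw [hFt s hs]
    rfl

/-- Contraction is injective on the volume forms of `W′` (dimensions matching): two volume forms with
the same contraction are equal. [folklore] -/
theorem restrictSlots_injOn [Fintype σ] [Fintype ι] [DecidableEq σ] [DecidableEq ι]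
    {W W' : Submodule k V} [FiniteDimensional k W'] [FiniteDimensional k W]
    {ω ω' : (Module.Dual k V) [⋀^σ]→ₗ[k] k} (hω : ω ∈ volOn σ W') (hω' : ω' ∈ volOn σ W')
    {e : ι → σ} (he : Injective e) (t : σ → Module.Dual k V) (hWW' : W ≤ W')
    (hWt : ∀ s, s ∉ Set.range e → ∀ w ∈ W, t s w = 0)
    (hW : ∀ v ∈ W', (∀ s, s ∉ Set.range e → t s v = 0) → v ∈ W)
    (hσ : Fintype.card σ = Module.finrank k W') (hι : Fintype.card ι = Module.finrank k W)
    (h : restrictSlots ω he t = restrictSlots ω' he t) : ω = ω' := by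
  by_contra hne
  have hsub : ω - ω' ∈ volOn σ W' := Submodule.sub_mem _ hω hω'
  refine restrictSlots_ne_zero hsub (sub_ne_zero.mpr hne) he t hWW' hWt hW hσ hι ?_
  ext x
  have hx := DFunLike.congr_fun h x
  simp only [restrictSlots_apply] at hx
  simp only [restrictSlots_apply, AlternatingMap.sub_apply, AlternatingMap.zero_apply, hx, sub_self]

/-- **Contraction is onto the volume forms of `W`** (dimensions matching): every volume form on `W`
is the contraction of a volume form on `W′` — both spaces of volume forms are lines and the
contraction of a generator is non-zero. [folklore] -/
theorem exists_restrictSlots_eq [Fintype σ] [Fintype ι] [DecidableEq σ] [DecidableEq ι]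
    {W W' : Submodule k V} [FiniteDimensional k W'] [FiniteDimensional k W]
    {e : ι → σ} (he : Injective e) (t : σ → Module.Dual k V) (hWW' : W ≤ W')
    (hWt : ∀ s, s ∉ Set.range e → ∀ w ∈ W, t s w = 0)
    (hW : ∀ v ∈ W', (∀ s, s ∉ Set.range e → t s v = 0) → v ∈ W)
    (hσ : Fintype.card σ = Module.finrank k W') (hι : Fintype.card ι = Module.finrank k W)
    {ε : (Module.Dual k V) [⋀^ι]→ₗ[k] k} (hε : ε ∈ volOn ι W) :
    ∃ ω ∈ volOn σ W', restrictSlots ω he t = ε := by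
  let b' : Basis σ k W' :=
    (Module.finBasisOfFinrankEq k W' hσ.symm).reindex (Fintype.equivFinOfCardEq rfl).symm
  let b : Basis ι k W :=
    (Module.finBasisOfFinrankEq k W hι.symm).reindex (Fintype.equivFinOfCardEq rfl).symm
  -- the contraction `r` of the generator `volOf b'` is a non-zero volume form on `W`
  have hr : restrictSlots (volOf b') he t ∈ volOn ι W :=
    restrictSlots_mem_volOn (volOf_mem_volOn b') he t hW
  have hr0 : restrictSlots (volOf b') he t ≠ 0 :=
    restrictSlots_ne_zero (volOf_mem_volOn b') (volOf_ne_zero b') he t hWW' hWt hW hσ hι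
  -- both `r` and `ε` are multiples of `volOf b`, with the multiplier of `r` non-zero
  set c := ε (fun i => Subspace.dualLift W (b.dualBasis i))
  set c' := restrictSlots (volOf b') he t (fun i => Subspace.dualLift W (b.dualBasis i))
  have hc' : c' ≠ 0 := fun h0 => hr0 (by
    rw [apply_eq_smul_volOf b hr]
    change c' • volOf b = 0
    rw [h0, zero_smul])
  refine ⟨(c * c'⁻¹) • volOf b', Submodule.smul_mem _ _ (volOf_mem_volOn b'), ?_⟩
  rw [restrictSlots_smul, apply_eq_smul_volOf b hr, apply_eq_smul_volOf b hε, smul_smul]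
  change (c * c'⁻¹ * c') • volOf b = c • volOf b
  rw [inv_mul_cancel_right₀ hc']

end Contract

end Summit.BirchSwinnertonDyer.Rank1Residual.GaloisImage.VolumeForm

end
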